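import Literature.InformationTheory.QuantumCodes.CSSEquivalence
import Literature.InformationTheory.Coding.GilbertVarshamovDual
import HarnessLib

/-!
# The `k = 1` CSS normal form: necessary conditions `(Z)`, `(X)` on a systematic pair `(A, s)`

LADDER-QEC (venture cell `qec`), census infrastructure for the last cell `(16, 1)` of the optimal-CSS-distance
table `n ≤ 16` (census/type-02/css161/README.md: no CSS `[[16,1,5]]`, COMPUTED by an exhaustive search of
this normal form; this file is the statement-side half of that claim and the reduction a kernel replay of
the search will consume).

THE REDUCTION (elementary linear algebra, proved here in the vocabulary of `CSS.lean`). Let `C` be a CSS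
code with check matrices `H^X`, `H^Z` on the qubit set `Q`, `B = rs H^Z` (the `Z`-stabilizers, `dim B = b =
rank H^Z`), `B^⊥ = ker H^Z`, `A = rs H^X ⊆ B^⊥` (commutation) and `k = dim ker H^Z − dim rs H^X = 1`, so `A` is a
HYPERPLANE of `B^⊥`.
* (`exists_reindex_rowSpZ_eq_sysCode`) `B` has an information set: after a bijective relabelling of the qubits
  `Q ≃ I ⊕ Iᶜ` (`|I| = rank H^Z`) the `Z`-stabilizer space is the SYSTEMATIC code `{(v, vA) : v ∈ 𝔽₂^I}` of a
  matrix `A : 𝔽₂^{I × Iᶜ}` (`Coding.sysCode A`, generator matrix `[I | A]`); the parameters `d^X, d^Z, k` are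
  unchanged (`CSSEquivalence.lean`).
* (`normalForm_of_sysCode`) For such a code: `B^⊥ = {(A u, u) : u ∈ 𝔽₂^{Iᶜ}}` (`Coding.eq_sumElim_of_orth`; `−1 = 1`
  is not even needed), the hyperplane `A ⊆ B^⊥` is cut out by a nonzero `s ∈ 𝔽₂^{Iᶜ}` — `(A u, u) ∈ rs H^X ⇒ ⟨u, s⟩ = 0`
  — and then every `(v, vA + s)` is a `Z`-LOGICAL (`∈ ker H^X ∖ rs H^Z`) and every `(A u, u)` with `⟨u, s⟩ = 1`
  is an `X`-LOGICAL (`∈ ker H^Z ∖ rs H^X`). Hence the NECESSARY CONDITIONS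
      `(Z)  ∀ v,            d^Z ≤ wt v + wt (vA + s)`,
      `(X)  ∀ u, ⟨u,s⟩ = 1: d^X ≤ wt u + wt (A u)`.
* (`exists_normalForm`) packaged for an arbitrary `CSSCode RX RZ Q` with `k = 1`: `∃ I A s` with `|I| = rank H^Z`,
  `s ≠ 0`, `(Z)`, `(X)` for `C.dZ`, `C.dX`.
So «no `(b, A, s)` with `b = |I|` satisfies `(Z) ∧ (X)` at `d`» implies «no CSS `[[n,1,≥ d]]` with `rank H^Z = b`»;
with the `X ↔ Z` swap one may take `b = rank H^Z ≥ rank H^X`. (The converse — every such `(A, s)` IS a CSS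
`[[n,1]]` code with exactly these logical cosets — is true and is how the instances were checked, but is not needed
for a nonexistence proof and is not stated.) Sorting `s = 1^w 0^{m−w}` and the search's row/column symmetries belong
to the replay file, not here. 0 `decide`, no computation; axioms standard. [folklore] throughout
(systematic generator matrices: MacWilliams–Sloane, *The Theory of Error-Correcting Codes* (1977) Ch. 1 §2;
CSS logical operators as `ker ∖ rs`: [BravyiEtAl2024] §4 Lemma 1, `CSS.lean`).
-/

namespace Summit.Ventures.QEC.Census.CSSNormalForm

open Matrix Literature.InformationTheory.QuantumCodes Literature.InformationTheory.Coding

variable {RX RZ : Type*} [Fintype RX] [Fintype RZ]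

/-! ## 1. The normal form of a CSS code whose `Z`-stabilizers are a systematic code -/

section SysCode

variable {κ μ : Type*} [Fintype κ] [Fintype μ] [DecidableEq κ] [DecidableEq μ]

/-- `H *ᵥ y = 0` iff `y` is orthogonal to the row space of `H`. [folklore] -/
theorem mulVec_eq_zero_iff_orth {R Q : Type*} [Fintype R] [Fintype Q] [DecidableEq R]
    (H : Matrix R Q (ZMod 2)) (y : Q → ZMod 2) : H *ᵥ y = 0 ↔ ∀ c ∈ rowSpace H, c ⬝ᵥ y = 0 := by
  constructor
  · intro hy c hc
    rw [dotProduct_comm]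
    exact dotProduct_eq_zero_of_mem_rowSpace hc hy
  · intro h
    funext r
    exact h (H r) (mem_rowSpace_of_vecMul_eq (Pi.single r 1) (single_one_vecMul r H))

omit [Fintype RX] [DecidableEq μ] in
/-- In a CSS code whose `Z`-stabilizers are the systematic code of `A`, every element of `ker H^Z` is
`(−A u, u)` with `u` its `μ`-part. [folklore] -/
theorem eq_sumElim_of_kerZ (C : CSSCode RX RZ (κ ⊕ μ)) {A : Matrix κ μ (ZMod 2)}
    (hZ : C.rowSpZ = sysCode A) {y : κ ⊕ μ → ZMod 2} (hy : C.HZ *ᵥ y = 0) :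
    y = Sum.elim (-(A *ᵥ fun j => y (Sum.inr j))) (fun j => y (Sum.inr j)) := by
  classical
  refine eq_sumElim_of_orth fun c hc => ?_
  have hc' : c ∈ C.rowSpZ := by rw [hZ]; exact hc
  exact ((mulVec_eq_zero_iff_orth C.HZ y).1 hy) c hc'

omit [Fintype RX] [DecidableEq κ] [DecidableEq μ] in
/-- Conversely every `(−A u, u)` lies in `ker H^Z`. [folklore] -/
theorem sumElim_mem_kerZ (C : CSSCode RX RZ (κ ⊕ μ)) {A : Matrix κ μ (ZMod 2)}
    (hZ : C.rowSpZ = sysCode A) (u : μ → ZMod 2) :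
    C.HZ *ᵥ Sum.elim (-(A *ᵥ u)) u = 0 := by
  classical
  rw [mulVec_eq_zero_iff_orth]
  intro c hc
  have hc' : c ∈ sysCode A := by rw [← hZ]; exact hc
  rw [eq_sumElim_of_mem_sysCode hc', sumElim_dotProduct]
  simp only [Sum.elim_inl, Sum.elim_inr]
  rw [dotProduct_neg, dotProduct_mulVec, neg_add_eq_zero]

omit [Fintype RX] [DecidableEq μ] in
/-- The `μ`-part map `y ↦ y ∘ inr` is injective on `ker H^Z`. [folklore] -/
theorem finrank_kerZ_le (C : CSSCode RX RZ (κ ⊕ μ)) {A : Matrix κ μ (ZMod 2)}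
    (hZ : C.rowSpZ = sysCode A) :
    Module.finrank (ZMod 2) C.kerZ ≤ Fintype.card μ := by
  let ρ : C.kerZ →ₗ[ZMod 2] (μ → ZMod 2) := (LinearMap.funLeft (ZMod 2) (ZMod 2) Sum.inr).comp C.kerZ.subtype
  have hρ : Function.Injective ρ := by
    intro y y' h
    apply Subtype.ext
    have hy := eq_sumElim_of_kerZ C hZ ((C.mem_kerZ_iff _).1 y.2)
    have hy' := eq_sumElim_of_kerZ C hZ ((C.mem_kerZ_iff _).1 y'.2)
    have h2 : (fun j => (y : κ ⊕ μ → ZMod 2) (Sum.inr j)) = fun j => (y' : κ ⊕ μ → ZMod 2) (Sum.inr j) := by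
      funext j; exact congr_fun h j
    rw [hy, hy', h2]
  have := LinearMap.finrank_le_finrank_of_injective hρ
  simpa [Module.finrank_fintype_fun_eq_card] using this

/-- **The `k = 1` normal form** for a CSS code whose `Z`-stabilizer space IS the systematic code of `A` on
`κ ⊕ μ`: there is a nonzero `s : μ → 𝔽₂` such that every `(v, vA + s)` is a `Z`-logical and every `(−A u, u)`
with `⟨u, s⟩ = 1` is an `X`-logical; in particular `(Z)` and `(X)` below hold. [folklore] -/
theorem normalForm_of_sysCode (C : CSSCode RX RZ (κ ⊕ μ)) {A : Matrix κ μ (ZMod 2)}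
    (hZ : C.rowSpZ = sysCode A) (hk : C.k = 1) :
    ∃ s : μ → ZMod 2, s ≠ 0 ∧
      (∀ v : κ → ZMod 2, C.HX *ᵥ Sum.elim v (v ᵥ* A + s) = 0 ∧ Sum.elim v (v ᵥ* A + s) ∉ C.rowSpZ) ∧
      (∀ u : μ → ZMod 2, u ⬝ᵥ s = 1 →
        C.HZ *ᵥ Sum.elim (-(A *ᵥ u)) u = 0 ∧ Sum.elim (-(A *ᵥ u)) u ∉ C.rowSpX) := by
  classical
  -- the μ-parts of the X-stabilizers form a proper subspace U of 𝔽₂^μ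
  let π : (κ ⊕ μ → ZMod 2) →ₗ[ZMod 2] (μ → ZMod 2) := LinearMap.funLeft (ZMod 2) (ZMod 2) Sum.inr
  let U : Submodule (ZMod 2) (μ → ZMod 2) := C.rowSpX.map π
  have hAK : C.rowSpX ≤ C.kerZ := C.rowSpX_le_kerZ
  have hfinA : Module.finrank (ZMod 2) C.rowSpX + 1 = Module.finrank (ZMod 2) C.kerZ := by
    have h1 := Submodule.finrank_mono hAK
    have h2 : C.k = Module.finrank (ZMod 2) C.kerZ - Module.finrank (ZMod 2) C.rowSpX := rfl
    omega
  have hU : U < ⊤ := by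
    refine lt_top_iff_ne_top.2 fun htop => ?_
    have h1 : Module.finrank (ZMod 2) U ≤ Module.finrank (ZMod 2) C.rowSpX := Submodule.finrank_map_le π _
    have h2 := finrank_kerZ_le C hZ
    have h3 : Module.finrank (ZMod 2) U = Fintype.card μ := by
      rw [htop, finrank_top, Module.finrank_fintype_fun_eq_card]
    omega
  obtain ⟨f, hf0, hUf⟩ := Submodule.exists_le_ker_of_lt_top U hU
  -- f is the dot product with s
  let s : μ → ZMod 2 := fun j => f (Pi.single j 1)
  have hfs : ∀ u : μ → ZMod 2, f u = u ⬝ᵥ s := by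
    intro u
    rw [LinearMap.pi_apply_eq_sum_univ f u, dotProduct]
    refine Finset.sum_congr rfl fun j _ => ?_
    rw [smul_eq_mul]
    congr 1
    congr 1
    funext i
    rw [Pi.single_apply]
    split_ifs with h1 h2 h2
    · rfl
    · exact (h2 h1.symm).elim
    · exact (h1 h2.symm).elim
    · rfl
  have hs0 : s ≠ 0 := by
    intro hs
    apply hf0
    refine LinearMap.ext fun u => ?_
    rw [hfs, hs, dotProduct_zero, LinearMap.zero_apply]
  -- the μ-part of an X-stabilizer is orthogonal to s
  have horth : ∀ a ∈ C.rowSpX, (fun j => a (Sum.inr j)) ⬝ᵥ s = 0 := by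
    intro a ha
    have hmem : (fun j => a (Sum.inr j)) ∈ U := ⟨a, ha, rfl⟩
    have h1 := hUf hmem
    rw [LinearMap.mem_ker, hfs] at h1
    exact h1
  refine ⟨s, hs0, fun v => ⟨?_, ?_⟩, fun u hu => ⟨sumElim_mem_kerZ C hZ u, ?_⟩⟩
  · -- (v, vA + s) commutes with every X-check: test against the rows of H^X
    funext r
    have ha : C.HX r ∈ C.rowSpX := mem_rowSpace_of_vecMul_eq (Pi.single r 1) (single_one_vecMul r C.HX)
    have hker : C.HZ *ᵥ C.HX r = 0 := (C.mem_kerZ_iff _).1 (hAK ha)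
    have hdec := eq_sumElim_of_kerZ C hZ hker
    change C.HX r ⬝ᵥ Sum.elim v (v ᵥ* A + s) = 0
    rw [hdec, sumElim_dotProduct]
    simp only [Sum.elim_inl, Sum.elim_inr]
    rw [dotProduct_add, horth _ ha, add_zero, neg_dotProduct, dotProduct_comm (A *ᵥ _) v,
      dotProduct_mulVec, dotProduct_comm _ (v ᵥ* A), neg_add_cancel]
  · -- (v, vA + s) is not a Z-stabilizer (else s = 0)
    intro hmem
    rw [hZ, mem_sysCode_iff] at hmem
    apply hs0
    funext j
    have h := hmem j
    simp only [Sum.elim_inr, Sum.elim_inl, Pi.add_apply] at h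
    have h' : (v ᵥ* A) j = ∑ i, v i * A i j := rfl
    rw [h'] at h
    -- h : Σ + s j = Σ
    have := add_left_cancel (a := ∑ i, v i * A i j) (b := s j) (c := 0) (by rw [add_zero]; exact h)
    exact this
  · -- (−A u, u) with ⟨u,s⟩ = 1 is not an X-stabilizer
    intro hmem
    have h := horth _ hmem
    simp only [Sum.elim_inr] at h
    rw [hu] at h
    exact one_ne_zero h

/-- **Consequences `(Z)` and `(X)`** (the two families of inequalities the search consumes): for `C` as above with
`k = 1`, `d^Z ≤ wt v + wt (vA + s)` for all `v`, and `d^X ≤ wt u + wt (A u)` for all `u` with `⟨u, s⟩ = 1`.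
[folklore] -/
theorem normalForm_ineq_of_sysCode (C : CSSCode RX RZ (κ ⊕ μ)) {A : Matrix κ μ (ZMod 2)}
    (hZ : C.rowSpZ = sysCode A) (hk : C.k = 1) :
    ∃ s : μ → ZMod 2, s ≠ 0 ∧
      (∀ v : κ → ZMod 2, C.dZ ≤ hammingNorm v + hammingNorm (v ᵥ* A + s)) ∧
      (∀ u : μ → ZMod 2, u ⬝ᵥ s = 1 → C.dX ≤ hammingNorm u + hammingNorm (A *ᵥ u)) := by
  obtain ⟨s, hs0, hZlog, hXlog⟩ := normalForm_of_sysCode C hZ hk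
  refine ⟨s, hs0, fun v => ?_, fun u hu => ?_⟩
  · have h := C.dZ_le_hammingNorm (hZlog v).1 (hZlog v).2
    rwa [hammingNorm_sumElim] at h
  · have h := C.dX_le_hammingNorm (hXlog u hu).1 (hXlog u hu).2
    rwa [hammingNorm_sumElim, hammingNorm_neg', add_comm] at h

end SysCode

/-! ## 2. Every `Z`-stabilizer space is systematic after a qubit relabelling (information sets) -/

section InformationSet

variable {R Q : Type*} [Fintype R] [Fintype Q] [DecidableEq Q]

omit [Fintype Q] [DecidableEq Q] in
/-- `(c H) q = ⟨c, column q of H⟩`. [folklore] -/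
theorem vecMul_eq_dotProduct_col (c : R → ZMod 2) (H : Matrix R Q (ZMod 2)) (q : Q) :
    (c ᵥ* H) q = c ⬝ᵥ H.col q := rfl

omit [DecidableEq Q] in
/-- **Information set of a row space.** For every binary matrix `H` there is a coordinate set `I` with
`|I| = rank H` such that restriction to `I` is a linear BIJECTION `rs H ≃ 𝔽₂^I` (the columns indexed by `I`
are a basis of the column space). [folklore] (MacWilliams–Sloane Ch. 1 §2: every linear code has a
systematic generator matrix after a coordinate permutation.) -/
theorem exists_infoSet (H : Matrix R Q (ZMod 2)) :
    ∃ I : Finset Q, I.card = H.rank ∧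
      Function.Bijective (fun z : rowSpace H => fun i : {q // q ∈ I} => (z : Q → ZMod 2) i.1) := by
  classical
  obtain ⟨I0, -, -, hsp, hli⟩ :=
    exists_linearIndepOn_extension (linearIndepOn_empty (ZMod 2) H.col) (Set.empty_subset Set.univ)
  have hsp' : ∀ q, H.col q ∈ Submodule.span (ZMod 2) (H.col '' I0) := fun q =>
    hsp ⟨q, Set.mem_univ q, rfl⟩
  -- the span of the chosen columns is the whole column space, of dimension |I0| = rank H
  have hspan : Submodule.span (ZMod 2) (Set.range H.col) = Submodule.span (ZMod 2) (H.col '' I0) := by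
    refine le_antisymm (Submodule.span_le.2 ?_) (Submodule.span_mono (Set.image_subset_range _ _))
    rintro _ ⟨q, rfl⟩
    exact hsp' q
  have hcard : Fintype.card I0 = H.rank := by
    rw [rank_eq_finrank_span_cols, hspan, Set.image_eq_range]
    exact (finrank_span_eq_card hli.linearIndependent).symm
  let I : Finset Q := I0.toFinset
  have hmemI : ∀ q, q ∈ I ↔ q ∈ I0 := fun q => Set.mem_toFinset
  -- restriction to I is injective on rs H
  let ρ : rowSpace H →ₗ[ZMod 2] ({q // q ∈ I} → ZMod 2) :=
    { toFun := fun z => fun i => (z : Q → ZMod 2) i.1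
      map_add' := fun _ _ => rfl
      map_smul' := fun _ _ => rfl }
  have hinj : Function.Injective ρ := by
    intro z z' hzz'
    apply Subtype.ext
    obtain ⟨c, hc⟩ := (mem_rowSpace_iff H _).1 (z - z').2
    rw [Submodule.coe_sub] at hc
    -- the functional ⟨c, ·⟩ vanishes on the chosen columns, hence on every column
    let L : (R → ZMod 2) →ₗ[ZMod 2] ZMod 2 :=
      { toFun := fun w => c ⬝ᵥ w
        map_add' := fun x y => dotProduct_add c x y
        map_smul' := fun a x => by rw [dotProduct_smul]; rfl }
    have hL : ∀ i ∈ I0, L (H.col i) = 0 := by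
      intro i hi
      change c ⬝ᵥ H.col i = 0
      rw [← vecMul_eq_dotProduct_col, hc]
      have := congr_fun hzz' ⟨i, (hmemI i).2 hi⟩
      change (z : Q → ZMod 2) i = (z' : Q → ZMod 2) i at this
      change ((z : Q → ZMod 2) - (z' : Q → ZMod 2)) i = 0
      rw [Pi.sub_apply, this, sub_self]
    have hLspan : Submodule.span (ZMod 2) (H.col '' I0) ≤ LinearMap.ker L := by
      rw [Submodule.span_le]
      rintro _ ⟨i, hi, rfl⟩
      exact hL i hi
    have hzero : (z : Q → ZMod 2) - (z' : Q → ZMod 2) = 0 := by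
      rw [← hc]
      funext q
      rw [vecMul_eq_dotProduct_col]
      exact hLspan (hsp' q)
    exact sub_eq_zero.1 hzero
  have hfin : Module.finrank (ZMod 2) (rowSpace H) = Module.finrank (ZMod 2) ({q // q ∈ I} → ZMod 2) := by
    rw [finrank_rowSpace_eq_rank, Module.finrank_fintype_fun_eq_card, ← hcard]
    refine Fintype.card_congr (Equiv.subtypeEquivRight fun q => (hmemI q).symm)
  refine ⟨I, ?_, hinj, (LinearMap.injective_iff_surjective_of_finrank_eq_finrank hfin).1 hinj⟩
  rw [← hcard, ← Set.toFinset_card]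

omit [Fintype RX] in
/-- **Systematic form of the `Z`-stabilizers.** Every CSS code is permutation-equivalent (same `X`- and `Z`-checks,
qubits relabelled along `Q ≃ I ⊕ Iᶜ`, `|I| = rank H^Z`) to one whose `Z`-stabilizer space is the systematic code
`{(v, vA)}` of some `A : 𝔽₂^{I × Iᶜ}`. [folklore] -/
theorem exists_reindex_rowSpZ_eq_sysCode (C : CSSCode RX RZ Q) :
    ∃ (I : Finset Q) (A : Matrix {q // q ∈ I} {q // q ∉ I} (ZMod 2)), I.card = C.HZ.rank ∧
      (C.reindex (Equiv.refl RX) (Equiv.refl RZ) (Equiv.sumCompl fun q => q ∈ I).symm).rowSpZ = sysCode A := by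
  classical
  obtain ⟨I, hcard, hbij⟩ := exists_infoSet C.HZ
  let ρ : C.rowSpZ →ₗ[ZMod 2] ({q // q ∈ I} → ZMod 2) :=
    { toFun := fun z => fun i => (z : Q → ZMod 2) i.1
      map_add' := fun _ _ => rfl
      map_smul' := fun _ _ => rfl }
  let e : C.rowSpZ ≃ₗ[ZMod 2] ({q // q ∈ I} → ZMod 2) := LinearEquiv.ofBijective ρ hbij
  have he : ∀ z : C.rowSpZ, ∀ i : {q // q ∈ I}, (z : Q → ZMod 2) i.1 = e z i := fun _ _ => rfl
  let A : Matrix {q // q ∈ I} {q // q ∉ I} (ZMod 2) := fun i j => (e.symm (Pi.single i 1) : Q → ZMod 2) j.1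
  -- graph property: on rs H^Z the coordinates outside I are the I-coordinates times A
  have hgraph : ∀ z : C.rowSpZ, ∀ j : {q // q ∉ I},
      (z : Q → ZMod 2) j.1 = ∑ i, (z : Q → ZMod 2) i.1 * A i j := by
    intro z j
    have hz : z = e.symm (e z) := (e.symm_apply_apply z).symm
    have hsum : e z = ∑ i, (e z i) • (Pi.single i 1 : {q // q ∈ I} → ZMod 2) := by
      funext i'
      rw [Finset.sum_apply, Finset.sum_eq_single i']
      · simp
      · intro b _ hb
        simp [Ne.symm hb]
      · intro h; exact (h (Finset.mem_univ _)).elim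
    conv_lhs => rw [hz, hsum, map_sum]
    rw [Submodule.coe_sum, Finset.sum_apply]
    refine Finset.sum_congr rfl fun i _ => ?_
    rw [map_smul, Submodule.coe_smul, Pi.smul_apply, smul_eq_mul, ← he]
  refine ⟨I, A, hcard, Submodule.ext fun v => ?_⟩
  rw [CSSCode.mem_rowSpZ_reindex_iff, mem_sysCode_iff]
  constructor
  · intro hv j
    have h := hgraph ⟨_, hv⟩ j
    simp only [Function.comp_apply, Equiv.sumCompl_symm_apply_neg j] at h
    rw [h]
    refine Finset.sum_congr rfl fun i _ => ?_
    simp [Equiv.sumCompl_symm_apply_pos i]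
  · intro hv
    -- v = (x, xA) with x its I-part; the row-space vector with I-part x pulls back to v
    let x : {q // q ∈ I} → ZMod 2 := fun i => v (Sum.inl i)
    let w : C.rowSpZ := e.symm x
    have hwI : ∀ i : {q // q ∈ I}, (w : Q → ZMod 2) i.1 = v (Sum.inl i) := by
      intro i
      rw [he, LinearEquiv.apply_symm_apply]
    suffices hvw : v ∘ (Equiv.sumCompl fun q => q ∈ I).symm = (w : Q → ZMod 2) by
      rw [hvw]; exact w.2
    funext q
    by_cases hq : q ∈ I
    · simp only [Function.comp_apply, Equiv.sumCompl_symm_apply_of_pos hq]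
      exact (hwI ⟨q, hq⟩).symm
    · simp only [Function.comp_apply, Equiv.sumCompl_symm_apply_of_neg hq]
      rw [hv ⟨q, hq⟩, hgraph w ⟨q, hq⟩]
      refine Finset.sum_congr rfl fun i _ => ?_
      rw [hwI]

end InformationSet

/-! ## 3. The packaged normal form of an arbitrary `k = 1` CSS code -/

/-- **`k = 1` CSS normal form (necessary conditions).** For every CSS code `C` with `k = 1` there are a coordinate
set `I` with `|I| = rank H^Z`, a matrix `A : 𝔽₂^{I × Iᶜ}` and a NONZERO `s : 𝔽₂^{Iᶜ}` such that
`(Z) ∀ v, d^Z(C) ≤ wt v + wt (vA + s)` and `(X) ∀ u, ⟨u, s⟩ = 1 → d^X(C) ≤ wt u + wt (A u)`.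
(Apply it to `C.swap` for the version with `|I| = rank H^X`.) [folklore] -/
theorem exists_normalForm {Q : Type*} [Fintype Q] [DecidableEq Q] (C : CSSCode RX RZ Q) (hk : C.k = 1) :
    ∃ (I : Finset Q) (A : Matrix {q // q ∈ I} {q // q ∉ I} (ZMod 2)) (s : {q // q ∉ I} → ZMod 2),
      I.card = C.HZ.rank ∧ s ≠ 0 ∧
      (∀ v : {q // q ∈ I} → ZMod 2, C.dZ ≤ hammingNorm v + hammingNorm (v ᵥ* A + s)) ∧
      (∀ u : {q // q ∉ I} → ZMod 2, u ⬝ᵥ s = 1 → C.dX ≤ hammingNorm u + hammingNorm (A *ᵥ u)) := by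
  classical
  obtain ⟨I, A, hcard, hsys⟩ := exists_reindex_rowSpZ_eq_sysCode C
  set C' := C.reindex (Equiv.refl RX) (Equiv.refl RZ) (Equiv.sumCompl fun q => q ∈ I).symm with hC'
  have hk' : C'.k = 1 := by rw [hC', CSSCode.reindex_k]; exact hk
  obtain ⟨s, hs0, hZ, hX⟩ := normalForm_ineq_of_sysCode C' hsys hk'
  refine ⟨I, A, s, hcard, hs0, fun v => ?_, fun u hu => ?_⟩
  · have h := hZ v
    rwa [hC', CSSCode.reindex_dZ] at h
  · have h := hX u hu
    rwa [hC', CSSCode.reindex_dX] at h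

end Summit.Ventures.QEC.Census.CSSNormalForm
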